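import Mathlib.CategoryTheory.Groupoid
import Mathlib.CategoryTheory.SingleObj
import Mathlib.CategoryTheory.Products.Basic
import Literature.IUT.HodgeTheaters.FrobeniusEtalePicturesProofs2
import HarnessLib

/-!
# [IUTchI] Cor. 3.7 (ii)+(iii) / Cor. 3.9 (ii): fullness of the PAIR poly-isomorphism is independent of the interface — WITNESS

S. Mochizuki, *Inter-universal Teichmüller theory I*, §3, Corollary 3.7 (ii), (iii) pp. 88–89 and Corollary 3.9
(ii) p. 92 (kurims final manuscript May 2020) [claim: Mochizuki2012, status: disputed]; cell node
`IUTchI:Cor3.9(ii)` (companion evidence). PROOF-ONLY file (theorems only, no definitions; the models live inside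
the proofs) over abc-iut-L5-t2's `ThetaHodgeTheaters.lean` / `FrobeniusEtalePictures.lean`.

Context. The interface `HodgeTheaterModel` carries the two laws `componentBase_full` (Cor. 3.7 (ii) "[full]")
and `componentUnits_full` (Cor. 3.7 (iii) "[full]"); the typed Cor. 3.9 (ii) statement
`FrobeniusPicture.EtalePermutationSymmetricUnits` is a theorem over the bare interface
(`FrobeniusEtalePicturesProofs2.lean`), while FULLNESS of the pair poly-isomorphism
`(†D⊢_v, 𝒪^×_{†C⊢_v}) ⥲ (‡D⊢_v, 𝒪^×_{‡C⊢_v})` was proved only under a JOINT lifting hypothesis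
(`ThetaHodgeTheater.thetaLinkPair_eq_full_of_full`, `FrobeniusPicture.etalePictureUnits_eq_full_of_full`,
abc-iut-L5-t12). This file certifies that the joint hypothesis is genuinely needed for fullness: there is a
model of the interface — hence satisfying BOTH separate laws — in which the pair poly-isomorphism of Cor. 3.7
(ii)+(iii), and the étale-picture-plus-units poly-isomorphism of Cor. 3.9 (ii), are NOT the full
poly-isomorphism (`exists_thetaLinkPair_ne_full`, `exists_etalePictureUnits_ne_full`). The model: every kind of
data is the one-object groupoid `B(ℤ/2)`, every functor the identity; the isomorphisms of collections of data
then induce only the DIAGONAL pairs `(g, g)`, so `(g, 1)` with `g ≠ 1` is not induced. Consequently a typed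
"pair-fullness" reading of Cor. 3.9 (ii) would need a third (joint) law on the interface; the permutation-symmetry
reading needs none. Record only; nothing here bears on the disputed parts of the series.
-/

namespace Literature.IUT.HodgeTheaters

open CategoryTheory

universe u v w

section Witness

variable {F : Type u} {K : Type v} {Fbar : Type w} [Field F] [NumberField F] [Field K]
  [NumberField K] [Algebra F K] [Field Fbar] [Algebra F Fbar] [Algebra K Fbar]
  {E : WeierstrassCurve F} [E.IsElliptic] {l : ℕ} {P : BadPlacePredicates K}
  (D : InitialThetaData F K Fbar E l P)

/-- **Witness** (Cor. 3.7 (ii)+(iii)): over the interface `HodgeTheaterModel` (both laws `componentBase_full`,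
`componentUnits_full` included) the PAIR poly-isomorphism `(†D⊢_v, 𝒪^×_{†C⊢_v}) ⥲ (‡D⊢_v, 𝒪^×_{‡C⊢_v})` induced by the
Θ-link need not be full: in the model with all data `B(ℤ/2)` and all functors the identity, only the diagonal
pairs are induced. [claim: Mochizuki2012, status: disputed] -/
theorem exists_thetaLinkPair_ne_full (x : D.V) :
    ∃ (M : HodgeTheaterModel.{u, v, w, 0} D) (HT : ThetaHodgeTheater M),
      HT.thetaLinkPair HT x ≠ PolyIso.full _ _ := by
  classical
  let G := Multiplicative (ZMod 2)
  let B := SingleObj G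
  let M : HodgeTheaterModel.{u, v, w, 0} D :=
    { Loc := fun _ => B, Fref := fun _ => SingleObj.star G, BaseFull := fun _ => B,
      baseFullOf := fun _ => 𝟭 B, Dash := fun _ => B, dashOf := fun _ => 𝟭 B,
      thetaOf := fun _ => 𝟭 B, tautLoc := fun _ => Iso.refl _, Base := fun _ => B,
      base := fun _ => 𝟭 B, dashOfBase := fun _ => 𝟭 B, baseCompat := fun _ => Iso.refl _,
      Units := fun _ => B, units := fun _ => 𝟭 B, Glob := B, FmodRef := SingleObj.star G,
      component := fun _ => 𝟭 B, componentRef := fun _ => Iso.refl _, thtOf := 𝟭 B,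
      tautGlob := Iso.refl _ }
  refine ⟨M, ThetaHodgeTheater.ref M, fun hfull => ?_⟩
  -- the non-diagonal pair `(g, 1)`, `g` the generator of `ℤ/2`
  let g : G := Multiplicative.ofAdd (1 : ZMod 2)
  have hg : g ≠ 1 := by decide
  let gIso : (SingleObj.star G : B) ≅ SingleObj.star G := Groupoid.isoEquivHom _ _ |>.symm g
  have hmem : Iso.prod gIso (Iso.refl (SingleObj.star G)) ∈
      (ThetaHodgeTheater.ref M).thetaLinkPair (ThetaHodgeTheater.ref M) x := by
    rw [hfull]; exact Set.mem_univ _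
  rw [ThetaHodgeTheater.thetaLinkPair_eq_range] at hmem
  obtain ⟨ψ, hψ⟩ := hmem
  have h1 := congrArg (fun i => i.hom.1) hψ
  have h2 := congrArg (fun i => i.hom.2) hψ
  simp [M, ThetaHodgeTheater.ref, gIso] at h1 h2
  -- first components give `ψ = g`, second components give `ψ = 𝟙 = 1`
  exact hg (h1.symm.trans (h2.trans (SingleObj.id_as_one G (SingleObj.star G))))

/-- **Witness** (Cor. 3.9 (ii)): in the same model the étale-picture-plus-units poly-isomorphism of a
Frobenius-picture (here the constant chain) between two vertices is NOT the full poly-isomorphism of pairs —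
so a "pair-fullness" reading of Cor. 3.9 (ii) is not derivable from the interface with its two separate laws,
whereas the typed permutation symmetry `EtalePermutationSymmetricUnits` is (`etalePermutationSymmetricUnits_holds`).
[claim: Mochizuki2012, status: disputed] -/
theorem exists_etalePictureUnits_ne_full (x : D.V) :
    ∃ (M : HodgeTheaterModel.{u, v, w, 0} D) (Fr : FrobeniusPicture M),
      Fr.etalePictureUnits x 0 0 ≠ PolyIso.full _ _ := by
  obtain ⟨M, HT, hne⟩ := exists_thetaLinkPair_ne_full D x
  refine ⟨M, ⟨fun _ => HT⟩, fun hfull => hne ?_⟩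
  rw [HT.thetaLinkPair_eq_range HT x]
  rw [FrobeniusPicture.etalePictureUnits_eq_range] at hfull
  exact hfull

end Witness

end Literature.IUT.HodgeTheaters
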